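import Summits.QuantumFields.YangMills.Theorems.BalabanUVNodesN15TwoSpacingGluingCutRowsDefect
import Summits.QuantumFields.YangMills.Theorems.BalabanUVNodesN15TwoSpacingGluingNeumannCoverRows
import Summits.QuantumFields.YangMills.Theorems.BalabanUVNodesN15PartitionTwoGridFitSecond
import Summits.QuantumFields.YangMills.Theorems.BalabanUVNodesN15VectorPiecePlain
import HarnessLib

/-!
# THE GLUING STEP AT TWO LATTICE SPACINGS, XXXII: THE TWO-GRID η-DEFECT OF THE COVER's REMAINDER ROW FOR ANY CUBE OPERATOR — FILE 71's ASSEMBLY WITH EVERY PARTITION-SIDE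
# LETTER DISCHARGED (the sampled partition `h_k` of the cover by side-`S` cubes, coarse spacing `L^{−k}`, fine spacing `L^{−(k+r)}`, King's pairing of fine bonds)
# (dag-n15-c g12, FILE 74; N15 = NE2, s1 «background-layer OPERATOR ingredient»)

Cell `pub-ymgap`, seat `pub-ymgap-dag-n15-c` (R134 (a); HUMAN RULING D-0062), generation 12.  `bears_on: R4∕N15 · K3⁷ SpineGivenEndpointR13SepCoPH (stmt-QuantumFields-20544)`.
Filed `--supports stmt-QuantumFields-20544 --as helper` — COUNT-NEUTRAL.  Theorems only (0 `def`, 0 `sorry`).  Imports BY NAME FILE 71 (`hasMaj_idef_commOp_lapOp_comp_of_cut`,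
`hasMaj_idef_nonlocal_cut`, `hasMaj_idef_commOp_comp_of_add_cut`), FILE 72 (`chiCube_coverCorner_eq_one_side`), FILE 67 (`abs_fgrad_coverH_le`, `abs_bgrad_coverH_le`, `abs_fgradAdj_fgrad_coverH_le`,
`abs_coverH_fine_sub_le`, `coverXi_offset`), FILE 66 (`coverXi_shift`), FILE 64 (`abs_fgrad_hcube_two_grid_le`), dag-n15-w4 (B) (`abs_bgrad_hcube_two_grid_le`, `abs_fgradAdj_fgrad_hcube_two_grid_le`),
FILE 65 (`fgrad_hcube_cut`, `bgrad_hcube_cut`, `fgradAdj_fgrad_hcube_cut`), dag-n15-a part 3 (`blkFine_comp_kingPrV`); nothing in the tree is modified.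

WHAT.  Torus `M_ν = 2qw` (blocks), cube `□_k` of side `S` at the cover's corner `c(k)` (`2m₀ + 2w + 1 ≤ S ≤ 2qw`), partition `h_k = hcube (2q) (coverXi M n w) k` at the coarse spacing
`n = L^k` and `h′_k` at the fine spacing `n′ = L^r·L^k`, King's pairing `π = kingPrV L k r M`, `P = pull π`; ANY cube operators `N` (coarse), `N′` (fine) and nonlocal parts `N_L`, `N_L′`:
* §1 ★ `coverFit_params` (the two-grid bookkeeping `s = L^r s′`, `ns = n′s′ = w⁻¹`, `s′ ≤ ⅓`), ★ `hasMaj_idef_commOp_zero` (`𝔇([0, M_{h′}]N′, [0, M_h]N) = 0`);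
* §2 ★★★ **`hasMaj_idef_commOp_comp_cover_of`**: from the coarse cut rows (`β`, `β₁`), the cut DEFECT rows `𝔇(χ′N′, χN)` (`m_G`), `𝔇(χ′∇′N′, χ∇N)`, `𝔇(χ′∇⁻′N′, χ∇⁻N)` (`m₁`), the fine nonlocal
  letter `N_L′ ≤ c_Ne^{−ρ₁d}`, the COMPOSITE `𝔇(N_L′, N_L)∘(M_h∘(M_χN)) ≤ 1_□(y′)r_Be^{−ρd}` and the images-type defect `𝔇(M_{h′}N_L′N′, M_hN_LN) ≤ 1_□1_□r₃e^{−δd}` (dag-n15-a N-IIk ∕ its lift):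
  `𝔇([Σ∇*∇ + N_L′, M_{h′_k}]N′, [Σ∇*∇ + N_L, M_{h_k}]N) ≤ 1_□(y′)·(r_loc + r_nl + r₃)·e^{−ρ|y−y′|_T}` with
  `r_loc = (d+1)(c₂m_G + o₂β + 2(c₁m₁ + o₁β₁))`, `r_nl = c_N(m_G + oβ)c_r + r_B`, `c₁ = π∕w`, `c₂ = 32π²∕w²`, `o = π(d+1)∕(L^k w)`, `o₁ = w⁻¹·(L^k w)⁻¹·(64π² + π²(d+1))`,
  `o₂ = w⁻²·(L^k w)⁻¹·(144π³ + 32π³(d+1))` — EVERY partition-side letter (FILE 67), fit (FILES 64∕67, (B)) and cut compatibility (FILE 65 on FILE 72's window) discharged here; the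
  five operator-side rows stay displayed (their U ≡ 1 instances are dag-n15-a N-IIc∕N-IIe∕N-IIh∕N-IIk on the doubled torus and P-IIc∕P-IId on the torus of record).

HONEST FRAMING ∕ LIMITS.  Lattice calculus + block-majorant bookkeeping over LANDED letters; the two-grid DIFFERENCE TEMPLATE of [B9] Thm 3.14 pp.426–427 applied to [B6] §2's remainder
row (2.92)–(2.93) p.239, (2.133)–(2.136) p.247 — at the level of SHAPES; nothing of [B5]∕[B6]∕[B9] asserted.  NE2⁺ NOT PRINTED, NOT proved; N15 NOT discharged; counts of record UNMOVED
(typed 28∕28 · discharged 5∕27); one finite 𝕋⁴ at fixed ε per index — NOT infinite volume, NOT OS on ℝ⁴, NOT a mass gap, NOT Clay; R4 closes the conditional finite-𝕋⁴ rung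
`BalabanLadder.UV` only.  Restate-immune (no Theses import).
-/

noncomputable section

namespace Summit.QuantumFields.YangMills.BalabanUVNodes.N15.Gluing

open Real
open Literature.MathematicalPhysics.QuantumFieldTheory.Balaban1983to89
open Literature.MathematicalPhysics.QuantumFieldTheory.Balaban1983to89.B5Prop11Plancherel (Tor fine)
open Literature.MathematicalPhysics.QuantumFieldTheory.Balaban1983to89.B11SectG (BlockNorm HasMaj RowSum hasMaj_zero)
open Literature.MathematicalPhysics.QuantumFieldTheory.Balaban1983to89.T4EtaRateDefect (idef idef_zero)
open Literature.MathematicalPhysics.QuantumFieldTheory.Balaban1983to89.T4EtaRateCoeffDefect (pull)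
open Literature.MathematicalPhysics.QuantumFieldTheory.Balaban1983to89.B6Prop26Gluing (mulOp ind ind_nonneg ind_le_one)
open Literature.MathematicalPhysics.QuantumFieldTheory.Balaban1983to89.B6UnitTorusCarrier (unitTorusGeo triangle254_unitTorusGeo unitTorusGeo_dist_nonneg)
open Literature.MathematicalPhysics.QuantumFieldTheory.King1986.Torus (blockOf tdistT tdistT_nonneg)
open Summit.QuantumFields.YangMills.BalabanUVNodes.N15.VectorPiece (bshiftEquiv kingPrV blkFine blkFine_comp_kingPrV)
open Summit.QuantumFields.YangMills.BalabanUVNodes.N15.BackgroundLayer (fgrad fgradAdj bgrad)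
open Summit.QuantumFields.YangMills.BalabanUVNodes.N15.TwoGrid (chiCube cubeBlocks)

variable {d : ℕ}

/-! ## §1 Bookkeeping -/

section Params

/-- ★ the two-grid parameters of the cover's partition: coarse step `s = (L^k w)⁻¹`, fine step `s′ = (L^r L^k w)⁻¹`, `s = L^r s′`, `ns = n′s′ = w⁻¹`, `0 ≤ s′ ≤ ⅓`, `s ≤ 1` (`3 ≤ L^k w`). [folklore] -/
theorem coverFit_params {L kk r w : ℕ} (hL : 1 ≤ L) (hw : 0 < w) (h3 : 3 ≤ L ^ kk * w) :
    (0 : ℝ) ≤ (((L ^ r * L ^ kk : ℕ) : ℝ) * w)⁻¹ ∧ (((L ^ r * L ^ kk : ℕ) : ℝ) * w)⁻¹ ≤ 1 / 3 ∧ (((L ^ r * L ^ kk : ℕ) : ℝ) * w)⁻¹ ≤ 1 ∧ (((L ^ kk : ℕ) : ℝ) * w)⁻¹ ≤ 1 ∧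
      (((L ^ kk : ℕ) : ℝ) * w)⁻¹ = ((L ^ r : ℕ) : ℝ) * (((L ^ r * L ^ kk : ℕ) : ℝ) * w)⁻¹ ∧ ((L ^ kk : ℕ) : ℝ) * (((L ^ kk : ℕ) : ℝ) * w)⁻¹ = ((w : ℝ))⁻¹ ∧
      ((L ^ r * L ^ kk : ℕ) : ℝ) * (((L ^ r * L ^ kk : ℕ) : ℝ) * w)⁻¹ = ((w : ℝ))⁻¹ := by
  have hLr : 1 ≤ L ^ r := Nat.one_le_pow _ _ hL
  have hLk : 1 ≤ L ^ kk := Nat.one_le_pow _ _ hL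
  have hw' : (0 : ℝ) < w := by exact_mod_cast hw
  have hLr' : (1 : ℝ) ≤ ((L ^ r : ℕ) : ℝ) := by exact_mod_cast hLr
  have hLk' : (1 : ℝ) ≤ ((L ^ kk : ℕ) : ℝ) := by exact_mod_cast hLk
  have h3' : (3 : ℝ) ≤ ((L ^ kk : ℕ) : ℝ) * w := by exact_mod_cast h3
  have hprod : ((L ^ r * L ^ kk : ℕ) : ℝ) = ((L ^ r : ℕ) : ℝ) * ((L ^ kk : ℕ) : ℝ) := by push_cast; ring
  have hA : (3 : ℝ) ≤ ((L ^ r * L ^ kk : ℕ) : ℝ) * w := by rw [hprod]; nlinarith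
  have h1w : (1 : ℝ) ≤ ((L ^ kk : ℕ) : ℝ) * w := by linarith
  refine ⟨by positivity, ?_, ?_, ?_, ?_, ?_, ?_⟩
  · rw [one_div]; exact inv_anti₀ (by norm_num) hA
  · exact inv_le_one_of_one_le₀ (by linarith)
  · exact inv_le_one_of_one_le₀ h1w
  · rw [hprod]; field_simp
  · field_simp
  · field_simp

end Params

/-! ## §2 The two-grid defect of the cover's remainder row for any cube operator -/

section Rows

variable {M : Fin (d + 1) → ℕ} [∀ μ, NeZero (M μ)] {L kk r w q m₀ S : ℕ} [NeZero L]

/-- ★ `𝔇([0, M_{h′}]∘N′, [0, M_h]∘N) = 0 ≤ 1_□1_□·0·e^{−δd}` (the `W := 0` slot of FILE 71). [folklore] -/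
theorem hasMaj_idef_commOp_zero {X X' : Type} [Fintype X] [Fintype X'] {g : B6.Geometry} (blk : X → g.Site) (pr : X' → X) (h : X → ℝ) (h' : X' → ℝ)
    (N : (X → ℝ) →ₗ[ℝ] (X → ℝ)) (N' : (X' → ℝ) →ₗ[ℝ] (X' → ℝ)) (P : Set g.Site) (δ : ℝ) :
    HasMaj (BlockNorm.ofBlocks g blk) (BlockNorm.ofBlocks g (blk ∘ pr))
      (idef (pull pr) (pull pr) (commOp (0 : (X' → ℝ) →ₗ[ℝ] (X' → ℝ)) h' ∘ₗ N') (commOp (0 : (X → ℝ) →ₗ[ℝ] (X → ℝ)) h ∘ₗ N))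
      (fun y y' => ind P y * ind P y' * (0 * Real.exp (-(δ * g.dist y y')))) := by
  have hz : ∀ {Y : Type} (hh : Y → ℝ), commOp (0 : (Y → ℝ) →ₗ[ℝ] (Y → ℝ)) hh = 0 := fun hh => by
    rw [commOp, LinearMap.zero_comp, LinearMap.comp_zero, sub_zero]
  rw [hz, hz, LinearMap.zero_comp, LinearMap.zero_comp, idef_zero]
  exact (hasMaj_zero _ _).mono fun y y' => le_of_eq (by ring)

/-- ★★★ **THE TWO-GRID η-DEFECT OF THE COVER's REMAINDER ROW FOR ANY CUBE OPERATOR** — FILE 71's three pieces with every partition-side letter, fit and cut compatibility of the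
cover discharged; displayed: the coarse cut rows, the three cut defect rows, the fine nonlocal letter, the composite `𝔇(N_L′, N_L)` row and the images-type defect row.
[cite: Balaban1984PropagatorsII, (2.92)–(2.93) p.239, (2.133)–(2.136) p.247 (shapes + mechanism); Balaban1985BackgroundPropagators, Thm 3.14 pp.426–427 (difference template)] -/
theorem hasMaj_idef_commOp_comp_cover_of (hM : ∀ ν, M ν = 2 * q * w) (hw : 0 < w) (hfit : 2 * m₀ + 2 * w + 1 ≤ S) (hS : S ≤ 2 * q * w) (h3 : 3 ≤ L ^ kk * w)
    (k : Fin (d + 1) → ZMod (2 * q))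
    {N NL : (Tor (fine (L ^ kk) M) × Fin (d + 1) → ℝ) →ₗ[ℝ] (Tor (fine (L ^ kk) M) × Fin (d + 1) → ℝ)}
    {N' NL' : (Tor (fine (L ^ r * L ^ kk) M) × Fin (d + 1) → ℝ) →ₗ[ℝ] (Tor (fine (L ^ r * L ^ kk) M) × Fin (d + 1) → ℝ)}
    {β β₁ mG m₁ cN rB r₃ δ ρ ρ₁ σ cr : ℝ} (hβ : 0 ≤ β) (hβ₁ : 0 ≤ β₁) (hmG : 0 ≤ mG) (hm₁ : 0 ≤ m₁) (hcN : 0 ≤ cN) (hr₃ : 0 ≤ r₃) (hρ : 0 ≤ ρ) (hρδ : ρ ≤ δ)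
    (hρ₁ : ρ + σ ≤ ρ₁) (hrow : RowSum (unitTorusGeo L kk M) σ cr)
    (hGc : HasMaj (BlockNorm.ofBlocks (unitTorusGeo L kk M) (fun b : Tor (fine (L ^ kk) M) × Fin (d + 1) => blockOf (L ^ kk) M b.1))
      (BlockNorm.ofBlocks (unitTorusGeo L kk M) (fun b : Tor (fine (L ^ kk) M) × Fin (d + 1) => blockOf (L ^ kk) M b.1))
      (mulOp (chiCube M (L ^ kk) (coverCorner M w q m₀ k) S) ∘ₗ N)
      (fun y y' => ind ((cubeBlocks M (coverCorner M w q m₀ k) S : Finset (Tor M)) : Set (Tor M)) y * ind ((cubeBlocks M (coverCorner M w q m₀ k) S : Finset (Tor M)) : Set (Tor M)) y' *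
        (β * Real.exp (-(δ * tdistT M y y')))))
    (hDc : ∀ μ, HasMaj (BlockNorm.ofBlocks (unitTorusGeo L kk M) (fun b : Tor (fine (L ^ kk) M) × Fin (d + 1) => blockOf (L ^ kk) M b.1))
      (BlockNorm.ofBlocks (unitTorusGeo L kk M) (fun b : Tor (fine (L ^ kk) M) × Fin (d + 1) => blockOf (L ^ kk) M b.1))
      (mulOp (chiCube M (L ^ kk) (coverCorner M w q m₀ k) S) ∘ₗ (fgrad ((L ^ kk : ℕ) : ℝ) (bshiftEquiv M (L ^ kk) μ) ∘ₗ N))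
      (fun y y' => ind ((cubeBlocks M (coverCorner M w q m₀ k) S : Finset (Tor M)) : Set (Tor M)) y * ind ((cubeBlocks M (coverCorner M w q m₀ k) S : Finset (Tor M)) : Set (Tor M)) y' *
        (β₁ * Real.exp (-(δ * tdistT M y y')))))
    (hDbc : ∀ μ, HasMaj (BlockNorm.ofBlocks (unitTorusGeo L kk M) (fun b : Tor (fine (L ^ kk) M) × Fin (d + 1) => blockOf (L ^ kk) M b.1))
      (BlockNorm.ofBlocks (unitTorusGeo L kk M) (fun b : Tor (fine (L ^ kk) M) × Fin (d + 1) => blockOf (L ^ kk) M b.1))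
      (mulOp (chiCube M (L ^ kk) (coverCorner M w q m₀ k) S) ∘ₗ (bgrad ((L ^ kk : ℕ) : ℝ) (bshiftEquiv M (L ^ kk) μ) ∘ₗ N))
      (fun y y' => ind ((cubeBlocks M (coverCorner M w q m₀ k) S : Finset (Tor M)) : Set (Tor M)) y * ind ((cubeBlocks M (coverCorner M w q m₀ k) S : Finset (Tor M)) : Set (Tor M)) y' *
        (β₁ * Real.exp (-(δ * tdistT M y y')))))
    (hIGc : HasMaj (BlockNorm.ofBlocks (unitTorusGeo L kk M) (fun b : Tor (fine (L ^ kk) M) × Fin (d + 1) => blockOf (L ^ kk) M b.1))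
      (BlockNorm.ofBlocks (unitTorusGeo L kk M) (fun i : Tor (fine (L ^ r * L ^ kk) M) × Fin (d + 1) => blockOf (L ^ r * L ^ kk) M i.1))
      (idef (pull (kingPrV L kk r M)) (pull (kingPrV L kk r M)) (mulOp (chiCube M (L ^ r * L ^ kk) (coverCorner M w q m₀ k) S) ∘ₗ N')
        (mulOp (chiCube M (L ^ kk) (coverCorner M w q m₀ k) S) ∘ₗ N))
      (fun y y' => ind ((cubeBlocks M (coverCorner M w q m₀ k) S : Finset (Tor M)) : Set (Tor M)) y * ind ((cubeBlocks M (coverCorner M w q m₀ k) S : Finset (Tor M)) : Set (Tor M)) y' *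
        (mG * Real.exp (-(δ * tdistT M y y')))))
    (hIDc : ∀ μ, HasMaj (BlockNorm.ofBlocks (unitTorusGeo L kk M) (fun b : Tor (fine (L ^ kk) M) × Fin (d + 1) => blockOf (L ^ kk) M b.1))
      (BlockNorm.ofBlocks (unitTorusGeo L kk M) (fun i : Tor (fine (L ^ r * L ^ kk) M) × Fin (d + 1) => blockOf (L ^ r * L ^ kk) M i.1))
      (idef (pull (kingPrV L kk r M)) (pull (kingPrV L kk r M))
        (mulOp (chiCube M (L ^ r * L ^ kk) (coverCorner M w q m₀ k) S) ∘ₗ (fgrad ((L ^ r * L ^ kk : ℕ) : ℝ) (bshiftEquiv M (L ^ r * L ^ kk) μ) ∘ₗ N'))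
        (mulOp (chiCube M (L ^ kk) (coverCorner M w q m₀ k) S) ∘ₗ (fgrad ((L ^ kk : ℕ) : ℝ) (bshiftEquiv M (L ^ kk) μ) ∘ₗ N)))
      (fun y y' => ind ((cubeBlocks M (coverCorner M w q m₀ k) S : Finset (Tor M)) : Set (Tor M)) y * ind ((cubeBlocks M (coverCorner M w q m₀ k) S : Finset (Tor M)) : Set (Tor M)) y' *
        (m₁ * Real.exp (-(δ * tdistT M y y')))))
    (hIDbc : ∀ μ, HasMaj (BlockNorm.ofBlocks (unitTorusGeo L kk M) (fun b : Tor (fine (L ^ kk) M) × Fin (d + 1) => blockOf (L ^ kk) M b.1))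
      (BlockNorm.ofBlocks (unitTorusGeo L kk M) (fun i : Tor (fine (L ^ r * L ^ kk) M) × Fin (d + 1) => blockOf (L ^ r * L ^ kk) M i.1))
      (idef (pull (kingPrV L kk r M)) (pull (kingPrV L kk r M))
        (mulOp (chiCube M (L ^ r * L ^ kk) (coverCorner M w q m₀ k) S) ∘ₗ (bgrad ((L ^ r * L ^ kk : ℕ) : ℝ) (bshiftEquiv M (L ^ r * L ^ kk) μ) ∘ₗ N'))
        (mulOp (chiCube M (L ^ kk) (coverCorner M w q m₀ k) S) ∘ₗ (bgrad ((L ^ kk : ℕ) : ℝ) (bshiftEquiv M (L ^ kk) μ) ∘ₗ N)))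
      (fun y y' => ind ((cubeBlocks M (coverCorner M w q m₀ k) S : Finset (Tor M)) : Set (Tor M)) y * ind ((cubeBlocks M (coverCorner M w q m₀ k) S : Finset (Tor M)) : Set (Tor M)) y' *
        (m₁ * Real.exp (-(δ * tdistT M y y')))))
    (hNL' : HasMaj (BlockNorm.ofBlocks (unitTorusGeo L kk M) (fun i : Tor (fine (L ^ r * L ^ kk) M) × Fin (d + 1) => blockOf (L ^ r * L ^ kk) M i.1))
      (BlockNorm.ofBlocks (unitTorusGeo L kk M) (fun i : Tor (fine (L ^ r * L ^ kk) M) × Fin (d + 1) => blockOf (L ^ r * L ^ kk) M i.1)) NL'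
      (fun y y' => cN * Real.exp (-(ρ₁ * tdistT M y y'))))
    (hT3 : HasMaj (BlockNorm.ofBlocks (unitTorusGeo L kk M) (fun b : Tor (fine (L ^ kk) M) × Fin (d + 1) => blockOf (L ^ kk) M b.1))
      (BlockNorm.ofBlocks (unitTorusGeo L kk M) (fun i : Tor (fine (L ^ r * L ^ kk) M) × Fin (d + 1) => blockOf (L ^ r * L ^ kk) M i.1))
      (idef (pull (kingPrV L kk r M)) (pull (kingPrV L kk r M)) NL' NL ∘ₗ
        (mulOp (hcube (2 * q) (coverXi M (L ^ kk) w) k) ∘ₗ (mulOp (chiCube M (L ^ kk) (coverCorner M w q m₀ k) S) ∘ₗ N)))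
      (fun y y' => ind ((cubeBlocks M (coverCorner M w q m₀ k) S : Finset (Tor M)) : Set (Tor M)) y' * (rB * Real.exp (-(ρ * tdistT M y y')))))
    (hD3 : HasMaj (BlockNorm.ofBlocks (unitTorusGeo L kk M) (fun b : Tor (fine (L ^ kk) M) × Fin (d + 1) => blockOf (L ^ kk) M b.1))
      (BlockNorm.ofBlocks (unitTorusGeo L kk M) (fun i : Tor (fine (L ^ r * L ^ kk) M) × Fin (d + 1) => blockOf (L ^ r * L ^ kk) M i.1))
      (idef (pull (kingPrV L kk r M)) (pull (kingPrV L kk r M)) (mulOp (hcube (2 * q) (coverXi M (L ^ r * L ^ kk) w) k) ∘ₗ (NL' ∘ₗ N'))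
        (mulOp (hcube (2 * q) (coverXi M (L ^ kk) w) k) ∘ₗ (NL ∘ₗ N)))
      (fun y y' => ind ((cubeBlocks M (coverCorner M w q m₀ k) S : Finset (Tor M)) : Set (Tor M)) y * ind ((cubeBlocks M (coverCorner M w q m₀ k) S : Finset (Tor M)) : Set (Tor M)) y' *
        (r₃ * Real.exp (-(δ * tdistT M y y'))))) :
    HasMaj (BlockNorm.ofBlocks (unitTorusGeo L kk M) (fun b : Tor (fine (L ^ kk) M) × Fin (d + 1) => blockOf (L ^ kk) M b.1))
      (BlockNorm.ofBlocks (unitTorusGeo L kk M) (fun i : Tor (fine (L ^ r * L ^ kk) M) × Fin (d + 1) => blockOf (L ^ r * L ^ kk) M i.1))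
      (idef (pull (kingPrV L kk r M)) (pull (kingPrV L kk r M))
        (commOp (lapOp ((L ^ r * L ^ kk : ℕ) : ℝ) (bshiftEquiv M (L ^ r * L ^ kk)) 0 + NL') (hcube (2 * q) (coverXi M (L ^ r * L ^ kk) w) k) ∘ₗ N')
        (commOp (lapOp ((L ^ kk : ℕ) : ℝ) (bshiftEquiv M (L ^ kk)) 0 + NL) (hcube (2 * q) (coverXi M (L ^ kk) w) k) ∘ₗ N))
      (fun y y' => ind ((cubeBlocks M (coverCorner M w q m₀ k) S : Finset (Tor M)) : Set (Tor M)) y' *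
        ((((d + 1 : ℕ) * (32 * π ^ 2 / (w : ℝ) ^ 2 * mG + ((w : ℝ))⁻¹ ^ 2 * (((L ^ kk : ℕ) : ℝ) * w)⁻¹ * (144 * π ^ 3 + 32 * π ^ 3 * (d + 1 : ℕ)) * β +
              2 * (π / w * m₁ + |((w : ℝ))⁻¹| * (((L ^ kk : ℕ) : ℝ) * w)⁻¹ * (64 * π ^ 2 + π ^ 2 * (d + 1 : ℕ)) * β₁)) + 0) +
            (cN * (mG + π * (d + 1) / (((L ^ kk : ℕ) : ℝ) * w) * β) * cr + rB) + r₃) *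
          Real.exp (-(ρ * tdistT M y y')))) := by
  have hL1 : 1 ≤ L := Nat.one_le_iff_ne_zero.mpr (NeZero.ne L)
  have hq : 0 < q := by
    rcases Nat.eq_zero_or_pos q with h | h
    · exact absurd (hM 0) (by subst h; simpa using NeZero.ne (M 0))
    · exact h
  have hfit1 : m₀ + 2 * w + 1 ≤ S := by omega
  obtain ⟨hs0, hs13, hs1', hs1, hsL, hn, hn'⟩ := coverFit_params (L := L) (kk := kk) (r := r) (w := w) hL1 hw h3
  -- blocks of the fine member through King's pairing
  have hblk : (fun i : Tor (fine (L ^ r * L ^ kk) M) × Fin (d + 1) => blockOf (L ^ r * L ^ kk) M i.1) =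
      (fun b : Tor (fine (L ^ kk) M) × Fin (d + 1) => blockOf (L ^ kk) M b.1) ∘ kingPrV L kk r M := (blkFine_comp_kingPrV (M := M) L kk r).symm
  rw [hblk] at hIGc hIDc hIDbc hNL' hT3 hD3 ⊢
  -- the cuts at both spacings
  have hχ := fun μ => chiCube_coverCorner_eq_one_side (M := M) (n := L ^ kk) (m₀ := m₀) hM hw hfit1 hS μ k
  have hχ' := fun μ => chiCube_coverCorner_eq_one_side (M := M) (n := L ^ r * L ^ kk) (m₀ := m₀) hM hw hfit1 hS μ k
  -- the coordinates' compatibilities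
  have hξ := fun μ ν b => coverXi_shift (n := L ^ kk) hM hw μ ν b
  have hξ' := fun μ ν b => coverXi_shift (n := L ^ r * L ^ kk) hM hw μ ν b
  have hoff := fun ν x' => coverXi_offset (M := M) (L := L) (kk := kk) (r := r) (w := w) (q := q) ν x'
  have hK : 2 ≤ 2 * q := by omega
  have hLr : 1 ≤ L ^ r := Nat.one_le_pow _ _ hL1
  -- the local part
  have hloc := hasMaj_idef_commOp_lapOp_comp_of_cut (g := unitTorusGeo L kk M) (fun b : Tor (fine (L ^ kk) M) × Fin (d + 1) => blockOf (L ^ kk) M b.1) (kingPrV L kk r M)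
    (J := Fin (d + 1)) (e := bshiftEquiv M (L ^ kk)) (e' := bshiftEquiv M (L ^ r * L ^ kk)) (n := ((L ^ kk : ℕ) : ℝ)) (n' := ((L ^ r * L ^ kk : ℕ) : ℝ))
    (by positivity : (0 : ℝ) ≤ π / w) (by positivity : (0 : ℝ) ≤ 32 * π ^ 2 / (w : ℝ) ^ 2)
    (by positivity : (0 : ℝ) ≤ |((w : ℝ))⁻¹| * (((L ^ kk : ℕ) : ℝ) * w)⁻¹ * (64 * π ^ 2 + π ^ 2 * Fintype.card (Fin (d + 1))))
    (by positivity : (0 : ℝ) ≤ ((w : ℝ))⁻¹ ^ 2 * (((L ^ kk : ℕ) : ℝ) * w)⁻¹ * (144 * π ^ 3 + 32 * π ^ 3 * Fintype.card (Fin (d + 1))))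
    (fun μ x' => abs_fgrad_coverH_le hM hw k μ x') (fun μ x' => abs_bgrad_coverH_le hM hw k μ x') (fun μ x' => abs_fgradAdj_fgrad_coverH_le hM hw k μ x')
    (fun μ x' => abs_fgrad_hcube_two_grid_le (2 * q) (coverXi M (L ^ kk) w) (coverXi M (L ^ r * L ^ kk) w) (kingPrV L kk r M) (bshiftEquiv M (L ^ kk))
      (bshiftEquiv M (L ^ r * L ^ kk)) hK hLr hs0 hs1' hsL hn hn' hξ hξ' hoff k μ x')
    (fun μ x' => abs_bgrad_hcube_two_grid_le (2 * q) (coverXi M (L ^ kk) w) (coverXi M (L ^ r * L ^ kk) w) (kingPrV L kk r M) (bshiftEquiv M (L ^ kk))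
      (bshiftEquiv M (L ^ r * L ^ kk)) hK hLr hs0 hs1' hsL hn hn' hξ hξ' hoff k μ x')
    (fun μ x' => abs_fgradAdj_fgrad_hcube_two_grid_le (2 * q) (coverXi M (L ^ kk) w) (coverXi M (L ^ r * L ^ kk) w) (kingPrV L kk r M) (bshiftEquiv M (L ^ kk))
      (bshiftEquiv M (L ^ r * L ^ kk)) hK hLr hs0 hs13 hs1 hsL hn hn' hξ hξ' hoff k μ x')
    (fun μ => fgradAdj_fgrad_hcube_cut (2 * q) (coverXi M (L ^ kk) w) (bshiftEquiv M (L ^ kk)) μ _ (hχ μ))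
    (fun μ => fgrad_hcube_cut (2 * q) (coverXi M (L ^ kk) w) (bshiftEquiv M (L ^ kk)) μ _ (hχ μ))
    (fun μ => bgrad_hcube_cut (2 * q) (coverXi M (L ^ kk) w) (bshiftEquiv M (L ^ kk)) μ _ (hχ μ))
    (fun μ => fgradAdj_fgrad_hcube_cut (2 * q) (coverXi M (L ^ r * L ^ kk) w) (bshiftEquiv M (L ^ r * L ^ kk)) μ _ (hχ' μ))
    (fun μ => fgrad_hcube_cut (2 * q) (coverXi M (L ^ r * L ^ kk) w) (bshiftEquiv M (L ^ r * L ^ kk)) μ _ (hχ' μ))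
    (fun μ => bgrad_hcube_cut (2 * q) (coverXi M (L ^ r * L ^ kk) w) (bshiftEquiv M (L ^ r * L ^ kk)) μ _ (hχ' μ))
    hGc hDc hDbc hIGc hIDc hIDbc
    (hasMaj_idef_commOp_zero (g := unitTorusGeo L kk M) (fun b : Tor (fine (L ^ kk) M) × Fin (d + 1) => blockOf (L ^ kk) M b.1) (kingPrV L kk r M) _ _ N N' _ δ)
  -- the split nonlocal part
  have hcut := hcube_cut (2 * q) (coverXi M (L ^ kk) w) (bshiftEquiv M (L ^ kk)) 0 (hχ 0)
  have hcut' := hcube_cut (2 * q) (coverXi M (L ^ r * L ^ kk) w) (bshiftEquiv M (L ^ r * L ^ kk)) 0 (hχ' 0)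
  have hnl := hasMaj_idef_nonlocal_cut (g := unitTorusGeo L kk M) (fun b : Tor (fine (L ^ kk) M) × Fin (d + 1) => blockOf (L ^ kk) M b.1) (kingPrV L kk r M)
    (triangle254_unitTorusGeo L kk M) (unitTorusGeo_dist_nonneg L kk M) hrow hcN (by positivity : (0 : ℝ) ≤ π * (d + 1) / (((L ^ kk : ℕ) : ℝ) * w)) hβ hmG hρ hρδ hρ₁
    (fun x' => abs_coverH_le_one k x') (fun x' => abs_coverH_fine_sub_le (L := L) (kk := kk) (r := r) hM hw k x') hNL' hGc hIGc hT3
  -- assembly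
  have key := hasMaj_idef_commOp_comp_of_add_cut (g := unitTorusGeo L kk M) (fun b : Tor (fine (L ^ kk) M) × Fin (d + 1) => blockOf (L ^ kk) M b.1) (kingPrV L kk r M)
    (unitTorusGeo_dist_nonneg L kk M) (by positivity) hr₃ hρδ hcut hcut' hloc hnl hD3
  refine key.mono fun y y' => le_of_eq ?_
  rw [Fintype.card_fin]

end Rows

end Summit.QuantumFields.YangMills.BalabanUVNodes.N15.Gluing

end
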